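import Summits.ValiantsHypothesis.ValiantsHypothesis.Theorems.BarrierLeverChowBenchmarkPairsBlockPeelTriples
import Mathlib.LinearAlgebra.Matrix.ToLinearEquiv

/-!
# Route BarrierLever — item 22038 `ChowBenchmarkPairs`, line `moore-peel`: the BLOCK PEEL, V — GOOD BLOCKS ARE
# CLOSED UNDER CONCATENATION (`det J^κ(i,t) ≠ 0 ∧ det J^κ(i+t,t') ≠ 0 ⇒ det J^κ(i,t+t') ≠ 0`), the stage family
# ⟷ block determinant bridge, and CONJECTURE B3 on THEOREM W's certified window

Helper file (`--supports stmt-ValiantsHypothesis-22038`; cell valiant-natproofs, rung V4, 𝒟-side benchmark of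
record, line `moore_peel`, planner SUCCESSOR MANDATE M1 (HOME/STATUS.md l.1824: «theory on the ∀h node
`Stmt.conjB3` — extreme monomial / stage factorisation of `det J^{!}(b,3)(Λ₀,Λ₁,Λ₂)`; model
`det_blockMatrix_one_ne_zero_iff` + THEOREM W»); seat val-np-p4 gen 30).  Closes NO item; definition-free.

THE THEOREM (memo `HOME/val-np-p4/g28/memo/MEMO-valnp4-g28.md` §1, «Concatenation»).  The two-scale extreme form of
the symbolic block determinant `det J^κ(i, t+t')(Λ)` — the first `t` points at a smaller scale than the last `t'` —
is `det J^κ(i,t) · (ratio-Vandermonde factors) · det J^κ(i+t,t')`; consequently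

* **`det_blockMatrix_X_ne_zero_append`**: `det J^κ(i,t) ≠ 0 → det J^κ(i+t,t') ≠ 0 → det J^κ(i,t+t') ≠ 0` in `ℤ[Λ]`
  (`1 ≤ i`, `κ` without zeros) — GOOD BLOCKS ARE CLOSED UNDER CONCATENATION; `det_blockMatrix_X_ne_zero_of_cuts`:
  any tiling of `[i, i+T)` by good blocks makes `J^κ(i,T)` good.

The Lean route is NOT the monomial bookkeeping but the kernel's own block peel: **`det_blockMatrix_X_ne_zero_of_linearIndependent`**
(if the rows alive at stage `(i, t)` — all `t` remaining points in ONE block, `i + t = h + 1` — are linearly independent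
over `MvPolynomial (Fin h) ℂ`, then `det J^κ(i,t)(Λ) ≠ 0`: their coordinate matrix is unitriangular on the fixed codes
`< c_i` and IS `blockMatrix κ i t (X_s)` on the multi-window `[c_i, c_{i+t})`, `krow_blockLabel_zero`; a null row vector
of the latter — `Matrix.exists_vecMul_eq_zero_iff` over the domain — corrected on the fixed rows is a dependence), combined
with `kblock_step` (twice) and `linearIndependent_kstageRows_terminal` of `…BlockPeel`/`…KernelPeel`.  With the converse
(`kblock_step` once) this is the bridge **`linearIndependent_stage_iff_det_blockMatrix_ne_zero`**.

CONSEQUENCES FOR CONJECTURE B3 (`Stmt.conjB3` of `…BlockPeelTriples`, by name):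
* `det_blockMatrix_three_ne_zero_of_singles / _of_single_double / _of_double_single`: a triple block with a good
  sub-tiling is good — so `Stmt.conjB3` has content ONLY at the triples `{i, i+1, i+2}` with no good sub-tiling (a bad
  stage of THEOREM W inside and the covering doubles singular; smallest instance `{444, 445, 446}`, memo g28 §3.1);
  `conjB3_iff_near_bad`: B3 ⟺ B3 at the triples containing a bad stage.
* **`det_blockMatrix_factorial_X_ne_zero_of_le_183`**: EVERY block `J^{!}(i,t)` with `1 ≤ i`, `i + t ≤ 183` is good
  (THEOREM W's window `det G_i ≠ 0`, `i ≤ 182`, `…DirichletSplit`, concatenated) — in particular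
  **`conjB3_instance_of_le_180`**: `det J^{!}(i,3)(Λ) ≠ 0` for every `1 ≤ i ≤ 180`, kernel-only (no computation).

WHAT THIS IS NOT: `Stmt.conjB3` (∀ i) and node #1 `stub_segmentMeanValue` (∀ h) stay OPEN; the extreme-monomial
COEFFICIENT identity itself is not formalised (only its nonvanishing consequence); nothing on crux
stmt-ValiantsHypothesis-14610 or on `VP` versus `VNP`.
-/

set_option linter.dupNamespace false

namespace Summit.ValiantsHypothesis.ValiantsHypothesis.Theorems.BarrierLever.MoorePeel

open Polynomial Finset

/-! ## 11. The rows of the first block ARE the block matrix -/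

/-- With the block starting at point `0` and no substitution, the kernel row of a block label is the block entry:
`krow κ r Y (blockLabel i 0 ρ) col = blockEntry κ i (s ↦ Y s) ρ col` (attached rows: `[T_q ⊆ T_col]·κ·Y_s^{col-q}`;
internal pair rows: `pairCoef`). -/
theorem krow_blockLabel_zero {R : Type*} [CommRing R] (κ : ℕ → ℕ) (r i : ℕ) {t : ℕ} (Y : ℕ → R)
    (ρ : BlockIdx i t) (col : Fin r) :
    krow κ r Y (blockLabel i 0 ρ) col = blockEntry κ i (fun s : Fin t => Y (s : ℕ)) ρ (col : ℕ) := by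
  by_cases hq : (ρ.2 : ℕ) < i
  · rw [blockLabel_of_lt ρ hq, blockEntry, if_pos hq, Nat.zero_add]
    simp only [krow, kincl]
    split_ifs with hsub
    · have e := add_bin_sdiff_eq hsub
      have e2 : (col : ℕ) - (ρ.2 : ℕ) = bin (bits (col : ℕ) \ bits (ρ.2 : ℕ)) := by omega
      rw [e2]
    · simp
  · rw [blockLabel_of_not_lt ρ hq, blockEntry, if_neg hq, Nat.zero_add, Nat.zero_add]
    simp only [krow, pairCoef]

/-- A sum over the rows alive at stage `(i, t)` — all `t` points in one block — splits into the fixed monomial rows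
`e_m`, `m < c_i`, and the block rows `blockLabel i 0 ρ`. -/
theorem sum_stageRows_eq_fixed_add_block {M : Type*} [AddCommMonoid M] (i t : ℕ) (f : RowLabel → M) :
    ∑ x ∈ stageRows i t, f x =
      ∑ m ∈ Finset.range (windowStart i), f (Sum.inl m) + ∑ ρ : BlockIdx i t, f (blockLabel i 0 ρ) := by
  classical
  have hdecomp : stageRows i t = (Finset.range (windowStart i)).image (fun m => (Sum.inl m : RowLabel)) ∪
      Finset.univ.image (blockLabel i 0 (t := t)) := by
    ext x
    simp only [Finset.mem_union, Finset.mem_image, Finset.mem_range, Finset.mem_univ, true_and]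
    constructor
    · intro hx
      have hx' : x ∈ stageRows i (0 + t) := by rwa [Nat.zero_add]
      rcases stageRows_trichotomy x hx' with h1 | ⟨ρ, hρ⟩ | ⟨cs, -⟩
      · rcases x with m | ⟨j, b⟩ | ⟨b, b'⟩
        · exact Or.inl ⟨m, inl_mem_stageRows.mp h1, rfl⟩
        · exact absurd (inr_inl_mem_stageRows.mp h1).2 (Nat.not_lt_zero _)
        · exact absurd (inr_inr_mem_stageRows.mp h1).2 (Nat.not_lt_zero _)
      · exact Or.inr ⟨ρ, hρ.symm⟩
      · exact absurd cs.1.2 (Nat.not_lt_zero _)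
    · rintro (⟨m, hm, rfl⟩ | ⟨ρ, rfl⟩)
      · exact inl_mem_stageRows.mpr hm
      · have hmem := blockLabel_mem (i := i) (n := 0) ρ
        rwa [Nat.zero_add] at hmem
  have hdisj : Disjoint ((Finset.range (windowStart i)).image (fun m => (Sum.inl m : RowLabel)))
      (Finset.univ.image (blockLabel i 0 (t := t))) := by
    rw [Finset.disjoint_left]
    intro x hx hx'
    obtain ⟨m, hm, rfl⟩ := Finset.mem_image.mp hx
    obtain ⟨ρ, -, hρ⟩ := Finset.mem_image.mp hx'
    have h1 : (Sum.inl m : RowLabel) ∈ stageRows i 0 := inl_mem_stageRows.mpr (Finset.mem_range.mp hm)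
    rw [← hρ] at h1
    exact blockLabel_not_mem ρ h1
  rw [hdecomp, Finset.sum_union hdisj, Finset.sum_image fun a _ b _ e => Sum.inl_injective e,
    Finset.sum_image fun a _ b _ e => blockLabel_injective e]

/-! ## 12. The bridge: stage family ⟷ block determinant -/

/-- **Linear independence of the one-block stage family forces a nonzero symbolic block determinant.**  Let
`i + t = h + 1`, `1 ≤ i`.  If the rows alive at stage `(i, t)` (fixed monomial rows and the block rows of ALL `t`
remaining points, symbolic Moore nodes) are linearly independent over `MvPolynomial (Fin h) ℂ`, then
`det J^κ(i,t)(Λ) ≠ 0` in `ℤ[Λ_0, …, Λ_{t-1}]`. -/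
theorem det_blockMatrix_X_ne_zero_of_linearIndependent (κ : ℕ → ℕ) (h i t : ℕ) (hit : i + t = h + 1)
    (hLI : LinearIndependent (MvPolynomial (Fin h) ℂ)
      (fun x : ↥(stageRows i t) => krow κ (windowStart (h + 1)) (nodeY h) (x : RowLabel))) :
    (blockMatrix κ i t (fun s : Fin t => (MvPolynomial.X s : MvPolynomial (Fin t) ℤ))).det ≠ 0 := by
  classical
  intro hdet
  -- the symbolic determinant specialises to `det J = 0` at the ratios `Λ_s = X_s`
  have hdetA : (blockMatrix κ i t (fun s : Fin t => nodeY h (s : ℕ))).det = 0 := by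
    have e := map_det_blockMatrix
      (MvPolynomial.eval₂Hom (Int.castRingHom (MvPolynomial (Fin h) ℂ)) (fun s : Fin t => nodeY h (s : ℕ)))
      κ i t (fun s : Fin t => (MvPolynomial.X s : MvPolynomial (Fin t) ℤ))
    rw [hdet, map_zero] at e
    simp only [MvPolynomial.coe_eval₂Hom, MvPolynomial.eval₂_X] at e
    exact e.symm
  obtain ⟨v, hv0, hvJ⟩ := Matrix.exists_vecMul_eq_zero_iff.mpr hdetA
  -- the multi-window fills the codes `[c_i, c_{h+1})`
  have hwidth : windowStart i + blockWidth i t = windowStart (h + 1) := by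
    rw [← hit, windowStart_add_blockWidth]
  have hwidth' : windowStart i + ∑ s : Fin t, (i + (s : ℕ)) = windowStart (h + 1) := hwidth
  -- coefficients of a dependence: `v` on the block rows, the correction on the fixed rows
  obtain ⟨coef, hcoef_inl, hcoef_inr⟩ : ∃ coef : RowLabel → MvPolynomial (Fin h) ℂ,
      (∀ m : ℕ, coef (Sum.inl m) = -∑ ρ, v ρ * blockEntry κ i (fun s : Fin t => nodeY h (s : ℕ)) ρ m) ∧
      (∀ y : (ℕ × ℕ) ⊕ (ℕ × ℕ), coef (Sum.inr y) = ∑ ρ, if blockLabel i 0 ρ = Sum.inr y then v ρ else 0) :=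
    ⟨fun x => Sum.elim (fun m : ℕ => -∑ ρ, v ρ * blockEntry κ i (fun s : Fin t => nodeY h (s : ℕ)) ρ m)
      (fun y : (ℕ × ℕ) ⊕ (ℕ × ℕ) => ∑ ρ, if blockLabel i 0 ρ = Sum.inr y then v ρ else 0) x,
      fun _ => rfl, fun _ => rfl⟩
  have hcoef_block : ∀ ρ₀ : BlockIdx i t, coef (blockLabel i 0 ρ₀) = v ρ₀ := by
    intro ρ₀
    obtain ⟨y, hy⟩ : ∃ y, blockLabel i 0 ρ₀ = Sum.inr y := by
      by_cases hq : (ρ₀.2 : ℕ) < i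
      · rw [blockLabel_of_lt ρ₀ hq]; exact ⟨_, rfl⟩
      · rw [blockLabel_of_not_lt ρ₀ hq]; exact ⟨_, rfl⟩
    rw [hy, hcoef_inr, ← hy]
    simp_rw [blockLabel_injective.eq_iff]
    rw [Finset.sum_ite_eq' Finset.univ ρ₀, if_pos (Finset.mem_univ _)]
  -- the dependence
  have hsum : ∑ x : ↥(stageRows i t),
      coef (x : RowLabel) • krow κ (windowStart (h + 1)) (nodeY h) (x : RowLabel) = 0 := by
    funext col
    rw [Finset.sum_apply, Pi.zero_apply]
    simp only [Pi.smul_apply, smul_eq_mul]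
    have hcs := Finset.sum_coe_sort (stageRows i t)
      (fun x : RowLabel => coef x * krow κ (windowStart (h + 1)) (nodeY h) x col)
    rw [hcs, sum_stageRows_eq_fixed_add_block]
    simp_rw [hcoef_block, krow_blockLabel_zero, hcoef_inl]
    have hfix : ∀ m : ℕ, krow κ (windowStart (h + 1)) (nodeY h) (Sum.inl m) col =
        if (col : ℕ) = m then (1 : MvPolynomial (Fin h) ℂ) else 0 := fun m => rfl
    simp_rw [hfix, mul_ite, mul_one, mul_zero]
    rw [Finset.sum_ite_eq (Finset.range (windowStart i)) (col : ℕ)]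
    by_cases hcol : (col : ℕ) < windowStart i
    · rw [if_pos (Finset.mem_range.mpr hcol), neg_add_cancel]
    · rw [if_neg (fun hm => hcol (Finset.mem_range.mp hm)), zero_add]
      -- the block part is `(v ᵥ* J) ρ'` at the column `ρ'` of the multi-window
      have hlt : (col : ℕ) - windowStart i < ∑ s : Fin t, (i + (s : ℕ)) := by
        have := col.2
        omega
      obtain ⟨ρ', hρ'⟩ : ∃ ρ' : BlockIdx i t, windowStart i + (finSigmaFinEquiv ρ' : ℕ) = (col : ℕ) := by
        refine ⟨finSigmaFinEquiv.symm ⟨(col : ℕ) - windowStart i, hlt⟩, ?_⟩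
        rw [Equiv.apply_symm_apply]
        show windowStart i + ((col : ℕ) - windowStart i) = (col : ℕ)
        omega
      have hv := congrFun hvJ ρ'
      simp only [Matrix.vecMul, dotProduct, Pi.zero_apply] at hv
      rw [← hv]
      refine Finset.sum_congr rfl fun ρ _ => ?_
      rw [blockMatrix, Matrix.of_apply, hρ']
  -- linear independence kills every coefficient, in particular `v`
  have hzero := (Fintype.linearIndependent_iff.mp hLI) (fun x => coef (x : RowLabel)) hsum
  apply hv0
  funext ρ
  have hmem : blockLabel i 0 ρ ∈ stageRows i t := by
    have hmem := blockLabel_mem (i := i) (n := 0) ρ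
    rwa [Nat.zero_add] at hmem
  have hρ : coef (blockLabel i 0 ρ) = 0 := hzero ⟨blockLabel i 0 ρ, hmem⟩
  rw [hcoef_block] at hρ
  exact hρ

/-- **The converse** (one block step from the terminal stage): a nonzero symbolic block determinant makes the
one-block stage family linearly independent. -/
theorem linearIndependent_stage_of_det_blockMatrix_X_ne_zero (κ : ℕ → ℕ) (hκ : ∀ k, κ k ≠ 0) (h i t : ℕ)
    (hit : i + t = h + 1) (hi : 1 ≤ i)
    (hJ : (blockMatrix κ i t (fun s : Fin t => (MvPolynomial.X s : MvPolynomial (Fin t) ℤ))).det ≠ 0) :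
    LinearIndependent (MvPolynomial (Fin h) ℂ)
      (fun x : ↥(stageRows i t) => krow κ (windowStart (h + 1)) (nodeY h) (x : RowLabel)) := by
  have term := linearIndependent_kstageRows_terminal κ h
  have step := kblock_step κ hκ h i t 0 (by omega) hi hJ (by rw [hit]; exact term)
  rw [Nat.zero_add] at step
  exact step

/-- **THE BRIDGE.**  For `i + t = h + 1`, `1 ≤ i`, `κ` without zeros: the rows alive at stage `(i, t)` are
linearly independent over `MvPolynomial (Fin h) ℂ` iff `det J^κ(i,t)(Λ) ≠ 0` in `ℤ[Λ]`. -/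
theorem linearIndependent_stage_iff_det_blockMatrix_ne_zero (κ : ℕ → ℕ) (hκ : ∀ k, κ k ≠ 0) (h i t : ℕ)
    (hit : i + t = h + 1) (hi : 1 ≤ i) :
    LinearIndependent (MvPolynomial (Fin h) ℂ)
      (fun x : ↥(stageRows i t) => krow κ (windowStart (h + 1)) (nodeY h) (x : RowLabel)) ↔
    (blockMatrix κ i t (fun s : Fin t => (MvPolynomial.X s : MvPolynomial (Fin t) ℤ))).det ≠ 0 :=
  ⟨det_blockMatrix_X_ne_zero_of_linearIndependent κ h i t hit,
    linearIndependent_stage_of_det_blockMatrix_X_ne_zero κ hκ h i t hit hi⟩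

/-! ## 13. Good blocks are closed under concatenation -/

/-- **CONCATENATION.**  If `det J^κ(i,t)(Λ) ≠ 0` and `det J^κ(i+t,t')(Λ') ≠ 0` (symbolic, `1 ≤ i`, `κ` without
zeros) then `det J^κ(i,t+t')(Λ'') ≠ 0`: the stages `i, …, i+t+t'-1` tied in ONE block are certified by the two
sub-blocks.  (Proof: terminal stage, two block steps, and the bridge.) -/
theorem det_blockMatrix_X_ne_zero_append (κ : ℕ → ℕ) (hκ : ∀ k, κ k ≠ 0) (i t t' : ℕ) (hi : 1 ≤ i)
    (h1 : (blockMatrix κ i t (fun s : Fin t => (MvPolynomial.X s : MvPolynomial (Fin t) ℤ))).det ≠ 0)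
    (h2 : (blockMatrix κ (i + t) t'
      (fun s : Fin t' => (MvPolynomial.X s : MvPolynomial (Fin t') ℤ))).det ≠ 0) :
    (blockMatrix κ i (t + t')
      (fun s : Fin (t + t') => (MvPolynomial.X s : MvPolynomial (Fin (t + t')) ℤ))).det ≠ 0 := by
  obtain ⟨h, hh⟩ : ∃ h : ℕ, h + 1 = i + t + t' := ⟨i + t + t' - 1, by omega⟩
  have term := linearIndependent_kstageRows_terminal κ h
  have step2 := kblock_step κ hκ h (i + t) t' 0 (by omega) (by omega) h2 (by rw [← hh]; exact term)
  have step1 := kblock_step κ hκ h i t (0 + t') (by omega) hi h1 step2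
  have e : 0 + t' + t = t + t' := by omega
  rw [e] at step1
  exact det_blockMatrix_X_ne_zero_of_linearIndependent κ h i (t + t') (by omega) step1

/-- **Tilings.**  Cut points `i = a 0 < a 1 < ⋯ < a m` with every block `J^κ(a q, a (q+1) - a q)` good make the
whole block `J^κ(i, a m - i)` good. -/
theorem det_blockMatrix_X_ne_zero_of_cuts (κ : ℕ → ℕ) (hκ : ∀ k, κ k ≠ 0) (m : ℕ) (a : ℕ → ℕ)
    (ha0 : 1 ≤ a 0) (hmono : ∀ q, q < m → a q < a (q + 1))
    (hJ : ∀ q, q < m → (blockMatrix κ (a q) (a (q + 1) - a q)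
      (fun s : Fin (a (q + 1) - a q) => (MvPolynomial.X s : MvPolynomial (Fin (a (q + 1) - a q)) ℤ))).det ≠ 0) :
    (blockMatrix κ (a 0) (a m - a 0)
      (fun s : Fin (a m - a 0) => (MvPolynomial.X s : MvPolynomial (Fin (a m - a 0)) ℤ))).det ≠ 0 := by
  induction m with
  | zero =>
    rw [Nat.sub_self]
    -- the empty block: a `0 × 0` determinant
    rw [Matrix.det_isEmpty]
    exact one_ne_zero
  | succ m ih =>
    have hle : a 0 ≤ a m := by
      clear ih hJ
      induction m with
      | zero => exact le_rfl
      | succ m ih' => exact le_trans (ih' fun q hq => hmono q (by omega)) (le_of_lt (hmono m (by omega)))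
    have hlt : a m < a (m + 1) := hmono m (by omega)
    have h1 := ih (fun q hq => hmono q (by omega)) (fun q hq => hJ q (by omega))
    have e1 : a 0 + (a m - a 0) = a m := by omega
    have h2 : (blockMatrix κ (a 0 + (a m - a 0)) (a (m + 1) - a m)
        (fun s : Fin (a (m + 1) - a m) =>
          (MvPolynomial.X s : MvPolynomial (Fin (a (m + 1) - a m)) ℤ))).det ≠ 0 := by
      rw [e1]
      exact hJ m (by omega)
    have happ := det_blockMatrix_X_ne_zero_append κ hκ (a 0) (a m - a 0) (a (m + 1) - a m) ha0 h1 h2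
    have e2 : a m - a 0 + (a (m + 1) - a m) = a (m + 1) - a 0 := by omega
    rw [e2] at happ
    exact happ

/-! ## 14. Triple blocks with a good sub-tiling; CONJECTURE B3 lives at the bad stages -/

/-- Three good singles make a good triple: `det G^κ_i, det G^κ_{i+1}, det G^κ_{i+2} ≠ 0 ⇒ det J^κ(i,3) ≠ 0`. -/
theorem det_blockMatrix_three_ne_zero_of_singles (κ : ℕ → ℕ) (hκ : ∀ k, κ k ≠ 0) (i : ℕ) (hi : 1 ≤ i)
    (h0 : (kpeelMatrix κ i).det ≠ 0) (h1 : (kpeelMatrix κ (i + 1)).det ≠ 0)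
    (h2 : (kpeelMatrix κ (i + 2)).det ≠ 0) :
    (blockMatrix κ i 3 (fun s : Fin 3 => (MvPolynomial.X s : MvPolynomial (Fin 3) ℤ))).det ≠ 0 := by
  have g0 := (det_blockMatrix_one_X_ne_zero_iff κ i).mpr h0
  have g1 := (det_blockMatrix_one_X_ne_zero_iff κ (i + 1)).mpr h1
  have g2 := (det_blockMatrix_one_X_ne_zero_iff κ (i + 2)).mpr h2
  have g01 := det_blockMatrix_X_ne_zero_append κ hκ i 1 1 hi g0 g1
  exact det_blockMatrix_X_ne_zero_append κ hκ i (1 + 1) 1 hi g01 g2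

/-- A good single followed by a good double makes a good triple. -/
theorem det_blockMatrix_three_ne_zero_of_single_double (κ : ℕ → ℕ) (hκ : ∀ k, κ k ≠ 0) (i : ℕ) (hi : 1 ≤ i)
    (h0 : (kpeelMatrix κ i).det ≠ 0)
    (h12 : (blockMatrix κ (i + 1) 2 (fun s : Fin 2 => (MvPolynomial.X s : MvPolynomial (Fin 2) ℤ))).det ≠ 0) :
    (blockMatrix κ i 3 (fun s : Fin 3 => (MvPolynomial.X s : MvPolynomial (Fin 3) ℤ))).det ≠ 0 :=
  det_blockMatrix_X_ne_zero_append κ hκ i 1 2 hi ((det_blockMatrix_one_X_ne_zero_iff κ i).mpr h0) h12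

/-- A good double followed by a good single makes a good triple. -/
theorem det_blockMatrix_three_ne_zero_of_double_single (κ : ℕ → ℕ) (hκ : ∀ k, κ k ≠ 0) (i : ℕ) (hi : 1 ≤ i)
    (h01 : (blockMatrix κ i 2 (fun s : Fin 2 => (MvPolynomial.X s : MvPolynomial (Fin 2) ℤ))).det ≠ 0)
    (h2 : (kpeelMatrix κ (i + 2)).det ≠ 0) :
    (blockMatrix κ i 3 (fun s : Fin 3 => (MvPolynomial.X s : MvPolynomial (Fin 3) ℤ))).det ≠ 0 :=
  det_blockMatrix_X_ne_zero_append κ hκ i 2 1 hi h01 ((det_blockMatrix_one_X_ne_zero_iff κ (i + 2)).mpr h2)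

/-- **CONJECTURE B3 lives at the bad stages.**  `Stmt.conjB3` holds iff it holds at the triples `{i, i+1, i+2}`
containing a bad stage of the one-point segment peel (`det G_j = 0`, `peelMatrix` of THEOREM W) — at every other
triple the three singles certify. -/
theorem conjB3_iff_near_bad :
    Stmt.conjB3 ↔ ∀ i : ℕ, 1 ≤ i →
      ((peelMatrix i).det = 0 ∨ (peelMatrix (i + 1)).det = 0 ∨ (peelMatrix (i + 2)).det = 0) →
      (blockMatrix Nat.factorial i 3 (fun s : Fin 3 => (MvPolynomial.X s : MvPolynomial (Fin 3) ℤ))).det ≠ 0 := by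
  constructor
  · exact fun hB3 i hi _ => hB3 i hi
  · intro hbad i hi
    by_cases hb : (peelMatrix i).det = 0 ∨ (peelMatrix (i + 1)).det = 0 ∨ (peelMatrix (i + 2)).det = 0
    · exact hbad i hi hb
    · push Not at hb
      obtain ⟨h0, h1, h2⟩ := hb
      rw [← kpeelMatrix_factorial] at h0 h1 h2
      exact det_blockMatrix_three_ne_zero_of_singles Nat.factorial (fun k => Nat.factorial_ne_zero k) i hi h0 h1 h2

/-! ## 15. Every block inside THEOREM W's certified window is good -/

/-- **All blocks of the window are good**: for `1 ≤ i` and `i + t ≤ 183`, `det J^{!}(i,t)(Λ) ≠ 0` in `ℤ[Λ]` — the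
stages `i, …, i+t-1 ≤ 182` are good singles (THEOREM W's certified window, `det_peelMatrix_ne_zero_of_le_182_by_W`),
concatenated. -/
theorem det_blockMatrix_factorial_X_ne_zero_of_le_183 (i t : ℕ) (hi : 1 ≤ i) (hit : i + t ≤ 183) :
    (blockMatrix Nat.factorial i t (fun s : Fin t => (MvPolynomial.X s : MvPolynomial (Fin t) ℤ))).det ≠ 0 := by
  have key := det_blockMatrix_X_ne_zero_of_cuts Nat.factorial (fun k => Nat.factorial_ne_zero k) t
    (fun q => i + q) (by omega) (fun q _ => by omega)
    (fun q hq => by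
      have e : i + (q + 1) - (i + q) = 1 := by omega
      exact det_blockMatrix_X_ne_zero_of_eq Nat.factorial (i + q) e
        (det_blockMatrix_factorial_one_ne_zero_of_le_182 (i + q) (by omega) (by omega)))
  have e : i + t - (i + 0) = t := by omega
  rw [e, Nat.add_zero] at key
  exact key

/-- **CONJECTURE B3 on the window, kernel-only**: `det J^{!}(i,3)(Λ_0,Λ_1,Λ_2) ≠ 0` for every `1 ≤ i ≤ 180`. -/
theorem conjB3_instance_of_le_180 (i : ℕ) (hi : 1 ≤ i) (hi' : i ≤ 180) :
    (blockMatrix Nat.factorial i 3 (fun s : Fin 3 => (MvPolynomial.X s : MvPolynomial (Fin 3) ℤ))).det ≠ 0 :=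
  det_blockMatrix_factorial_X_ne_zero_of_le_183 i 3 hi (by omega)

end Summit.ValiantsHypothesis.ValiantsHypothesis.Theorems.BarrierLever.MoorePeel
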